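import Summits.QuantumFields.YangMills.Theorems.LangevinControlUVLatticeGapInUVUnitsDecayToClustering

/-!
# Crux `LatticeGapInUVUnitsC`, line `nested-shell-rho-mixing`: stub S3 `stub_boxDecayToClustering`

Support file for item stmt-QuantumFields-16206 (route `LangevinControlUV` of `YangMills`), registered stub
`stub_boxDecayToClustering` ("decay ⇒ clustering, the currency exchange"), the BOX analogue of the
slab result `LatticeGapInUVUnits.FemtoSlabNondegeneracy.stub_decayToClustering`: for the torus Wilson state
`μ = wilsonMeasure r.ρ β` on `(ℤ/(2S+1))⁴` (time = axis `0`), GEOMETRIC DECAY `q^j` of the variance of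
`μ[F | links based ≥ jD away from a box in SOME coordinate]` for bounded measurable box observables `F`
(a box is `{ℓ | ∀ ν, (ℓ.1 ν − x ν).val < w}`, the links based in the cube of side `w` cornered at `x`)
implies EXPONENTIAL CLUSTERING `|corr_β(A, B, n)| ≤ C(A,B) e^{−(κ/D) n}` for `n ≤ S`, `D ≥ 1`, with
`κ = κ(q) > 0` chosen before `A, B` and `C` uniform in `β, S, D, n`.

Proof (`BoxDecayToClustering.abs_latticeConnectedCorr_le_of_boxDecay` + the final assembly): support
bookkeeping mod `2S+1` in all four coordinates — with `M − 1` the largest `|e.1 k|` over both supports,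
`A ∘ lift` reads only the box of side `2M+1` cornered at `(−M, −M, −M, −M)` (the slab file's
`val_sub_neg_lt`, coordinatewise) and `τ_n B ∘ lift` only links whose TIME coordinate is `≥ jD` base
layers away from it, `j = ⌊(n − 2M)/D⌋` (`WilsonBlockHeatBath.shiftedObservable_props`, the slab file's
`not_val_sub_lt` at `ν = 0`), hence it is measurable for the exterior σ-algebra of the `jD`-enlarged box;
then the abstract covariance bound `DecayToClustering.abs_cov_le` (pull-out property and
`2 s |∫ u v| ≤ ∫ u² + s² ∫ v²`, `s = e^{−κ j}`, `s² = q₁^j`, `q₁ = max q ½`, `κ = −log q₁ / 2`) and the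
a priori bound `2 C_A C_B` (`HypercubicLimit.Negative.abs_latticeConnectedCorr_le`) for `n < 2M + D`;
the exponent comparison is verbatim from the slab file.  No definition is introduced.
-/

open scoped BigOperators
open MeasureTheory Filter Topology
open Literature.MathematicalPhysics.QuantumFieldTheory Literature.MathematicalPhysics.QuantumLattice
open Literature.MathematicalPhysics.QuantumLattice.WilsonBlockHeatBath

noncomputable section

namespace Summit.QuantumFields.YangMills.Theorems.LatticeGapInUVUnitsC.NestedShell

open Summit.QuantumFields.YangMills.Theorems.LatticeGapInUVUnits.FemtoSlabNondegeneracy.DecayToClustering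

namespace BoxDecayToClustering

/-- Coordinates of the base point of a projected edge: `(torusEdge N (x, i)).1 ν = x ν (mod N)`. -/
theorem torusEdge_fst_apply (N : ℕ) (x : Literature.Probability.LatticeModels.Site 4) (i ν : Fin 4) :
    (torusEdge N (x, i)).1 ν = ((x ν : ℤ) : ZMod N) := rfl

variable {G : Type} [Group G] [TopologicalSpace G] [IsTopologicalGroup G] [CompactSpace G]
  [MeasurableSpace G] [BorelSpace G]

/-- **Decay ⇒ clustering, main regime, box version** (`2M + jD ≤ n ≤ S`, `jD ≥ 1`, both supports within
the cube `[-M, M]⁴` of `ℤ⁴`): `|corr_β(A, B, n)| ≤ 2 (C_A² + C_B²) s` whenever `q^j ≤ s²`, `s > 0`, given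
the box conditional-expectation decay hypothesis at `(β, S, D, q)` (adapted from the slab file's
`DecayToClustering.abs_latticeConnectedCorr_le_of_decay`). -/
theorem abs_latticeConnectedCorr_le_of_boxDecay (r : LatticeRep G) {q : ℝ} (A B : YMSpecies G)
    {CA CB : ℝ} (hCA : ∀ U, |A.F U| ≤ CA) (hCB : ∀ U, |B.F U| ≤ CB) {M : ℕ} (hM : 1 ≤ M)
    (hMA : ∀ e ∈ A.supp, ∀ k, (e.1 k).natAbs ≤ M) (hMB : ∀ e ∈ B.supp, ∀ k, (e.1 k).natAbs ≤ M)
    (β : ℝ) {S D n j : ℕ} (hnS : n ≤ S) (hjD : 1 ≤ j * D) (hjn : 2 * M + j * D ≤ n)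
    {s : ℝ} (hs : 0 < s) (hqs : q ^ j ≤ s ^ 2)
    (hdec : ∀ (x : Fin 4 → ZMod (2 * S + 1)) (w j : ℕ), w + 2 * (j * D) ≤ 2 * S →
      ∀ F : GaugeConfig 4 (2 * S + 1) G → ℝ, Measurable F → (∃ M : ℝ, ∀ U, |F U| ≤ M) →
      DependsOn F {ℓ : Edge 4 (2 * S + 1) | ∀ ν, (ℓ.1 ν - x ν).val < w} →
      ∫ U, (((wilsonMeasure (d := 4) (L := 2 * S + 1) r.ρ β)[F|cylinderEvents
        (X := fun _ : Edge 4 (2 * S + 1) => G) {ℓ : Edge 4 (2 * S + 1) | ∀ ν,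
          (ℓ.1 ν - (x ν - ((j * D - 1 : ℕ) : ZMod (2 * S + 1)))).val < w + 2 * (j * D - 1)}ᶜ]) U -
        ∫ V, F V ∂(wilsonMeasure (d := 4) (L := 2 * S + 1) r.ρ β)) ^ 2
          ∂(wilsonMeasure (d := 4) (L := 2 * S + 1) r.ρ β) ≤
      q ^ j * ∫ U, (F U - ∫ V, F V ∂(wilsonMeasure (d := 4) (L := 2 * S + 1) r.ρ β)) ^ 2
        ∂(wilsonMeasure (d := 4) (L := 2 * S + 1) r.ρ β)) :
    |latticeConnectedCorr r.ρ β (2 * S + 1) A.F B.F n| ≤ 2 * (CA ^ 2 + CB ^ 2) * s := by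
  -- adapted from LatticeGapInUVUnits.FemtoSlabNondegeneracy.DecayToClustering.abs_latticeConnectedCorr_le_of_decay
  haveI : IsProbabilityMeasure (wilsonMeasure (d := 4) (L := 2 * S + 1) r.ρ β) :=
    isProbabilityMeasure_wilsonMeasure (d := 4) (L := 2 * S + 1) r.ρ r.continuous β
  obtain ⟨hfm, -, -, hfdep⟩ := shiftedObservable_props A ((0 : ℕ) : ℤ) (2 * S + 1)
  obtain ⟨hgm, -, -, hgdep⟩ := shiftedObservable_props B ((n : ℕ) : ℤ) (2 * S + 1)
  rw [latticeConnectedCorr_eq_integral_sub]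
  -- the box of `A`: side `2M+1`, corner `(-M, -M, -M, -M)`
  have hsubA : (↑(A.supp.image fun e => torusEdge (2 * S + 1) (e.1 + Pi.single 0 ((0 : ℕ) : ℤ), e.2)) :
      Set (Edge 4 (2 * S + 1))) ⊆
      {ℓ : Edge 4 (2 * S + 1) | ∀ ν, (ℓ.1 ν - -((M : ℕ) : ZMod (2 * S + 1))).val < 2 * M + 1} := by
    intro ℓ hℓ
    rw [Finset.coe_image] at hℓ
    obtain ⟨e, he, rfl⟩ := hℓ
    intro ν
    have hb := hMA e (Finset.mem_coe.1 he) ν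
    have e0 : (torusEdge (2 * S + 1) (e.1 + Pi.single 0 ((0 : ℕ) : ℤ), e.2)).1 ν =
        ((e.1 ν : ℤ) : ZMod (2 * S + 1)) := by
      rw [torusEdge_fst_apply]
      simp only [Pi.add_apply, Nat.cast_zero, Pi.single_zero, Pi.zero_apply, add_zero]
    rw [e0]
    exact val_sub_neg_lt (by omega) (by omega) (by omega)
  have hwj : 2 * M + 1 + 2 * (j * D) ≤ 2 * S := by omega
  have key := hdec (fun _ => -((M : ℕ) : ZMod (2 * S + 1))) (2 * M + 1) j hwj _ hfm ⟨CA, fun U => hCA _⟩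
    (hfdep.mono hsubA)
  -- `τ_n B` reads only the exterior of the `jD`-enlarged box: its time coordinate is out of range
  have hsubB : (↑(B.supp.image fun e => torusEdge (2 * S + 1) (e.1 + Pi.single 0 ((n : ℕ) : ℤ), e.2)) :
      Set (Edge 4 (2 * S + 1))) ⊆
      {ℓ : Edge 4 (2 * S + 1) | ∀ ν, (ℓ.1 ν - (-((M : ℕ) : ZMod (2 * S + 1)) -
        ((j * D - 1 : ℕ) : ZMod (2 * S + 1)))).val < 2 * M + 1 + 2 * (j * D - 1)}ᶜ := by
    intro ℓ hℓ
    rw [Finset.coe_image] at hℓ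
    obtain ⟨e, he, rfl⟩ := hℓ
    have hb := hMB e (Finset.mem_coe.1 he) 0
    rw [Set.mem_compl_iff, Set.mem_setOf_eq]
    intro h
    have h0 := h 0
    rw [torusEdge_fst_apply, Pi.add_apply, Pi.single_eq_same] at h0
    exact not_val_sub_lt (by omega) (by omega) h0
  have hgm' : StronglyMeasurable[cylinderEvents (X := fun _ : Edge 4 (2 * S + 1) => G)
      {ℓ : Edge 4 (2 * S + 1) | ∀ ν, (ℓ.1 ν - (-((M : ℕ) : ZMod (2 * S + 1)) -
        ((j * D - 1 : ℕ) : ZMod (2 * S + 1)))).val < 2 * M + 1 + 2 * (j * D - 1)}ᶜ]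
      (fun U : GaugeConfig 4 (2 * S + 1) G =>
        B.F (configShift (-Pi.single 0 ((n : ℕ) : ℤ)) (torusLift (2 * S + 1) U))) :=
    (hgm.measurable_cylinderEvents_of_dependsOn (hgdep.mono hsubB)).stronglyMeasurable
  exact abs_cov_le cylinderEvents_le_pi hfm.aestronglyMeasurable hgm' (fun U => hCA _) (fun U => hCB _)
    hs hqs key

end BoxDecayToClustering

open BoxDecayToClustering in
/-- **Stub S3 of line `nested-shell-rho-mixing`** (decay ⇒ clustering, the currency exchange, box
version): for every `0 ≤ q < 1` there is `κ = κ(q) > 0` such that for every pair of gauge-invariant local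
observables there is `C(A,B)` with `|corr_β(A,B,n)| ≤ C e^{−(κ/D) n}` for `n ≤ S`, `D ≥ 1`, whenever the
conditional expectations of bounded box observables of the torus Wilson state given the links based `≥ jD`
away from the box (in some coordinate) decay like `q^j` in variance. -/
theorem stub_boxDecayToClustering : ∀ (G : Type) [Group G] [TopologicalSpace G] [IsTopologicalGroup G] [CompactSpace G] [MeasurableSpace G] [BorelSpace G] (r : LatticeRep G) (q : ℝ), 0 ≤ q → q < 1 → ∃ κ : ℝ, 0 < κ ∧ ∀ A B : YMSpecies G, ∃ C : ℝ, ∀ (β : ℝ) (S D n : ℕ) (μ : Measure (GaugeConfig 4 (2 * S + 1) G)), μ = (wilsonMeasure r.ρ β : Measure (GaugeConfig 4 (2 * S + 1) G)) → 1 ≤ D → n ≤ S → (∀ (x : Fin 4 → ZMod (2 * S + 1)) (w j : ℕ), w + 2 * (j * D) ≤ 2 * S → ∀ F : GaugeConfig 4 (2 * S + 1) G → ℝ, Measurable F → (∃ M : ℝ, ∀ U, |F U| ≤ M) → DependsOn F {ℓ : Edge 4 (2 * S + 1) | ∀ ν, (ℓ.1 ν - x ν).val < w} → ∫ U, ((μ[F|cylinderEvents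 {ℓ : Edge 4 (2 * S + 1) | ∀ ν, (ℓ.1 ν - (x ν - ((j * D - 1 : ℕ) : ZMod (2 * S + 1)))).val < w + 2 * (j * D - 1)}ᶜ]) U - ∫ V, F V ∂μ) ^ 2 ∂μ ≤ q ^ j * ∫ U, (F U - ∫ V, F V ∂μ) ^ 2 ∂μ) → |latticeConnectedCorr r.ρ β (2 * S + 1) A.F B.F n| ≤ C * Real.exp (-(κ / D * n)) := by
  -- adapted from LatticeGapInUVUnits.FemtoSlabNondegeneracy.stub_decayToClustering (slab version)
  intro G _ _ _ _ _ _ r q hq0 hq1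
  -- WLOG `q ≥ 1/2`, so that `κ := -log q₁ / 2` is a positive real
  set q₁ : ℝ := max q (1 / 2) with hq₁
  have hq₁0 : 0 < q₁ := lt_max_of_lt_right one_half_pos
  have hq₁1 : q₁ < 1 := max_lt hq1 one_half_lt_one
  have hqq₁ : q ≤ q₁ := le_max_left _ _
  have hlog : Real.log q₁ < 0 := Real.log_neg hq₁0 hq₁1
  set κ : ℝ := -Real.log q₁ / 2 with hκ
  have hκ0 : 0 < κ := by rw [hκ]; linarith
  have hq₁κ : Real.exp (-2 * κ) = q₁ := by
    rw [hκ, show -2 * (-Real.log q₁ / 2) = Real.log q₁ by ring, Real.exp_log hq₁0]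
  refine ⟨κ, hκ0, fun A B => ?_⟩
  obtain ⟨CA, hCA⟩ := A.bounded
  obtain ⟨CB, hCB⟩ := B.bounded
  have hCA0 : 0 ≤ CA := (abs_nonneg _).trans (hCA fun _ => 1)
  have hCB0 : 0 ≤ CB := (abs_nonneg _).trans (hCB fun _ => 1)
  -- `M - 1` bounds every coordinate of every base point in both supports
  obtain ⟨M, hM⟩ : ∃ M : ℕ, M = (A.supp ∪ B.supp).sup
      (fun e => (Finset.univ : Finset (Fin 4)).sup fun k => (e.1 k).natAbs) + 1 := ⟨_, rfl⟩
  have hM1 : 1 ≤ M := by omega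
  have hMAB : ∀ e ∈ A.supp ∪ B.supp, ∀ k, (e.1 k).natAbs ≤ M := fun e he k => by
    rw [hM]
    refine le_trans ?_ (Nat.le_succ _)
    refine le_trans ?_ (Finset.le_sup
      (f := fun e : Literature.MathematicalPhysics.QuantumLattice.ZdEdge 4 =>
        (Finset.univ : Finset (Fin 4)).sup fun k => (e.1 k).natAbs) he)
    exact Finset.le_sup (f := fun k : Fin 4 => (e.1 k).natAbs) (Finset.mem_univ k)
  have hMA : ∀ e ∈ A.supp, ∀ k, (e.1 k).natAbs ≤ M := fun e he =>
    hMAB e (Finset.mem_union_left _ he)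
  have hMB : ∀ e ∈ B.supp, ∀ k, (e.1 k).natAbs ≤ M := fun e he =>
    hMAB e (Finset.mem_union_right _ he)
  set K : ℝ := Real.exp (κ * (2 * M + 1)) with hK
  have hK0 : 0 < K := Real.exp_pos _
  refine ⟨(2 * (CA ^ 2 + CB ^ 2) + 2 * (CA * CB)) * K, fun β S D n μ hμ hD hnS hdec => ?_⟩
  subst hμ
  have hD0 : (0 : ℝ) < D := Nat.cast_pos.2 (by omega)
  have hD1 : (1 : ℝ) ≤ D := by exact_mod_cast hD
  have hMD : (2 * M : ℝ) ≤ 2 * M * D := le_mul_of_one_le_right (by positivity) hD1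
  -- exponent comparison, both regimes
  have hexp : ∀ x : ℝ, (n : ℝ) ≤ x * D + (2 * M + 1) * D →
      Real.exp (-(κ * x)) ≤ K * Real.exp (-(κ / D * n)) := by
    intro x hx
    rw [hK, ← Real.exp_add]
    refine Real.exp_le_exp.2 ?_
    have h3 : κ / D * n ≤ κ * x + κ * (2 * M + 1) := by
      rw [div_mul_eq_mul_div, div_le_iff₀ hD0]
      calc κ * n ≤ κ * (x * D + (2 * M + 1) * D) := mul_le_mul_of_nonneg_left hx hκ0.le
        _ = (κ * x + κ * (2 * M + 1)) * D := by ring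
    linarith
  by_cases hn : 2 * M + D ≤ n
  · -- main regime: `j := ⌊(n - 2M)/D⌋ ≥ 1`
    obtain ⟨j, hj⟩ : ∃ j : ℕ, j = (n - 2 * M) / D := ⟨_, rfl⟩
    have hjD : j * D ≤ n - 2 * M := hj ▸ Nat.div_mul_le_self _ _
    have hlt : n - 2 * M < j * D + D := hj ▸ Nat.lt_div_mul_add (by omega)
    have hj1 : 1 ≤ j := by rw [hj, Nat.le_div_iff_mul_le (by omega)]; omega
    have hjD1 : 1 ≤ j * D := Nat.mul_pos (by omega) (by omega)
    have hjn : 2 * M + j * D ≤ n := by omega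
    set s : ℝ := Real.exp (-(κ * j)) with hs
    have hs0 : 0 < s := Real.exp_pos _
    have hqs : q ^ j ≤ s ^ 2 := by
      calc q ^ j ≤ q₁ ^ j := pow_le_pow_left₀ hq0 hqq₁ j
        _ = s ^ 2 := by
          rw [← hq₁κ, hs, ← Real.exp_nat_mul, ← Real.exp_nat_mul]
          congr 1; push_cast; ring
    have hmain :=
      abs_latticeConnectedCorr_le_of_boxDecay r A B hCA hCB hM1 hMA hMB β hnS hjD1 hjn hs0 hqs hdec
    have hsK : s ≤ K * Real.exp (-(κ / D * n)) := hexp j (by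
      have h1 : ((n - 2 * M : ℕ) : ℝ) < j * D + D := by exact_mod_cast hlt
      rw [Nat.cast_sub (by omega)] at h1
      push_cast at h1
      linarith)
    have hnonneg : 0 ≤ 2 * (CA * CB) * K * Real.exp (-(κ / D * n)) := by positivity
    calc |latticeConnectedCorr r.ρ β (2 * S + 1) A.F B.F n| ≤ 2 * (CA ^ 2 + CB ^ 2) * s := hmain
      _ ≤ 2 * (CA ^ 2 + CB ^ 2) * (K * Real.exp (-(κ / D * n))) :=
          mul_le_mul_of_nonneg_left hsK (by positivity)
      _ ≤ (2 * (CA ^ 2 + CB ^ 2) + 2 * (CA * CB)) * K * Real.exp (-(κ / D * n)) := by linarith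
  · -- small separations: the a priori bound
    have hap := Summit.QuantumFields.YangMills.Theorems.HypercubicLimit.Negative.abs_latticeConnectedCorr_le
      r β (2 * S + 1) hCA hCB n
    have h1K : 1 ≤ K * Real.exp (-(κ / D * n)) := by
      have h := hexp 0 (by
        have : (n : ℝ) < 2 * M + D := by exact_mod_cast Nat.lt_of_not_le hn
        linarith)
      simpa using h
    have hnonneg : 0 ≤ 2 * (CA ^ 2 + CB ^ 2) * K * Real.exp (-(κ / D * n)) := by positivity
    calc |latticeConnectedCorr r.ρ β (2 * S + 1) A.F B.F n| ≤ 2 * (CA * CB) := hap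
      _ ≤ 2 * (CA * CB) * (K * Real.exp (-(κ / D * n))) := le_mul_of_one_le_right (by positivity) h1K
      _ ≤ (2 * (CA ^ 2 + CB ^ 2) + 2 * (CA * CB)) * K * Real.exp (-(κ / D * n)) := by linarith

end Summit.QuantumFields.YangMills.Theorems.LatticeGapInUVUnitsC.NestedShell

end
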